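import Literature.AlgebraicGeometry.Resolution.BlowupAlgebraStrictTransform
import Literature.AlgebraicGeometry.Resolution.BlowupAlgebraPresentation
import Mathlib.RingTheory.RingHom.Smooth
import Mathlib.RingTheory.Smooth.Basic
import Mathlib.RingTheory.FinitePresentation
import HarnessLib

/-!
# The charts of the blow-up of affine space in the origin: `k[X₀, …, X_n][I/Xᵢ] = k[X_j/Xᵢ : j ≠ i][Xᵢ]`

Topic: `Literature/AlgebraicGeometry/Resolution`. Commutative algebra for the construction of
de Jong 1996, proof of Lemma 4.11 (p. 68): the blowing up `b : P̃ → ℙ^{d+1}` of projective space in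
the vertex `p = (0 : … : 0 : 1)` with its projection `q = pr_p : P̃ → ℙ^d` ("Locally in the étale
topology, `f` along `Eᵢ` looks like `pr_p : P̃^d → ℙ^{d-1}` along the exceptional fibre of the
blowing up `P̃^d → ℙ^d` of `ℙ^d` in `p`"), the named fact `DeJong1996VertexBlowupProjection` of
`AlterationsLemma411Vertex.lean`. Over the chart `D₊(x_{d+1}) = Spec k[X₀, …, X_d] = 𝔸^{d+1}` the
vertex is the origin `V(X₀, …, X_d)` and the blowing up is covered by the spectra of the affine
blowup algebras `Cᵢ = k[X][I/Xᵢ] ⊆ k[X][1/Xᵢ]`, `I = (X₀, …, X_d)` (Stacks, Tag 0804;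
`blowupAlgebra`, `AffineBlowupAlgebra.lean`), on which `q` is `Spec` of
`βᵢ : k[Y_j : j ≠ i] → Cᵢ`, `Y_j ↦ X_j/Xᵢ`. This file PROVES the classical description of these
charts (Eisenbud–Harris, *3264 and All That*, §9.3.2; Hartshorne II Ex. 7.12 / I §4 p. 29: the
blow-up of `𝔸ⁿ` at the origin is covered by the affine spaces `Spec k[xᵢ, x_j/xᵢ]`):

* `blowupAlgebra.congrEquiv` — transport of `A[I/a]` along a ring isomorphism `e : A ≅ A'`:
  `A[I/a] ≅ A'[e(I)/e(a)]`, compatibly with the structure maps and the generators (the map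
  `blowupAlgebraMap` of `BlowupStrictTransform.lean` is bijective for an isomorphism: its kernel is
  the `a`-saturation of `0`, `mem_ker_blowupAlgebraMap_iff`);
* `PointBlowup.baseHom n k i : k[Y_j : j ≠ i] →ₐ[k] Cᵢ`, `Y_j ↦ X_j/Xᵢ` — the chart ring map of the
  projection `q`; `PointBlowup.polyHom n k i : (k[Y_j : j ≠ i])[T] → Cᵢ`, `T ↦ Xᵢ`, and
  **`PointBlowup.polyHom_bijective`: `Cᵢ` is the polynomial ring in `Xᵢ` over `k[X_j/Xᵢ : j ≠ i]`**
  (surjective because `X_j = Xᵢ · (X_j/Xᵢ)`; injective by mapping `k[X][1/Xᵢ]` to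
  `k[Y][T, T⁻¹]`, `Xᵢ ↦ T`, `X_j ↦ Y_j T`, under which `Cᵢ` goes to `k[Y][T]`);
  `PointBlowup.polyEquiv` the resulting ring isomorphism;
* `PointBlowup.smooth_baseHom` — hence `βᵢ` is a smooth ring map (`q` is smooth on the chart:
  "`q : P̃ → ℙ^d` is smooth (a `ℙ¹`-bundle)");
* `PointBlowup.quotientBaseHom_bijective` — and `k[Y_j : j ≠ i] → Cᵢ/(Xᵢ)` is bijective: the
  exceptional divisor `V(Xᵢ) ⊂ Spec Cᵢ` maps isomorphically onto the chart `D₊(yᵢ) = Spec k[Y]`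
  of `ℙ^d` ("the exceptional divisor `E = b⁻¹(p) ≅ ℙ^d` being a section" of `q`).

Everything here is PROVED; no named facts. The polynomial ring in one variable over
`B = k[Y_j : j ≠ i]` is written `MvPolynomial Unit B` (smooth over `B` by Mathlib's instances).

## Sources

* A. J. de Jong, *Smoothness, semi-stability and alterations*, Publ. Math. IHÉS 83 (1996),
  proof of Lemma 4.11, p. 68. [DeJong1996]
* D. Eisenbud, J. Harris, *3264 and All That* (2016), §9.3.2 and Prop. 9.11 (the blow-up of `ℙⁿ`
  in a point with its projection to `ℙ^{n-1}` is a `ℙ¹`-bundle). [EisenbudHarris2016]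
* The Stacks Project, Tag 0804 (the blowing up is covered by the `Spec A[I/a]`), Tag 052Q.
  [StacksProject]
-/

noncomputable section

open IsLocalization

namespace Literature.AlgebraicGeometry.Resolution

universe u

/-! ## Transport of the affine blowup algebra along a ring isomorphism -/

namespace blowupAlgebra

variable {A A' : Type u} [CommRing A] [CommRing A'] (e : A ≃+* A') (I : Ideal A) (a : A)

/-- `e(I) ≤ e(I)`-shaped hypothesis of `blowupAlgebraMap` for the isomorphism `e`. [folklore] -/
theorem map_toRingHom_le : I.map e.toRingHom ≤ I.map e.toRingHom := le_rfl

/-- The map `A[I/a] → A'[e(I)/e(a)]` induced by a ring isomorphism `e` is bijective: surjective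
as for any surjection (`blowupAlgebraMap_surjective`), injective because its kernel is the
`a`-saturation of `(ker e) A[I/a] = 0` and `a` is a non-zero-divisor of `A[I/a]`. [folklore] -/
theorem blowupAlgebraMap_bijective_of_ringEquiv :
    Function.Bijective (blowupAlgebraMap e.toRingHom I (I.map e.toRingHom) a le_rfl) := by
  refine ⟨?_, blowupAlgebraMap_surjective e.toRingHom I _ a e.surjective le_rfl le_rfl⟩
  rw [injective_iff_map_eq_zero]
  intro g hg
  obtain ⟨N, hN⟩ := (mem_ker_blowupAlgebraMap_iff e.toRingHom I (I.map e.toRingHom) a le_rfl g).mp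
    (by rwa [RingHom.mem_ker])
  have hker : RingHom.ker e.toRingHom = ⊥ := (RingHom.injective_iff_ker_eq_bot _).mp e.injective
  rw [hker, Ideal.map_bot, Ideal.mem_bot] at hN
  exact blowupAlgebra.eq_zero_of_pow_mul_eq_zero I a hN

/-- **Transport of the affine blowup algebra along a ring isomorphism**: `A[I/a] ≅ A'[e(I)/e(a)]`.
[folklore] -/
def congrEquiv : blowupAlgebra I a ≃+* blowupAlgebra (I.map e.toRingHom) (e a) :=
  RingEquiv.ofBijective _ (blowupAlgebraMap_bijective_of_ringEquiv e I a)

/-- `congrEquiv` on the image of `A`: `r ↦ e(r)`. [folklore] -/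
@[simp]
theorem congrEquiv_algebraMap (r : A) :
    congrEquiv e I a (algebraMap A (blowupAlgebra I a) r) = algebraMap A' _ (e r) :=
  blowupAlgebraMap_algebraMap e.toRingHom I _ a le_rfl r

/-- `congrEquiv` on the generators: `x/a ↦ e(x)/e(a)`. [folklore] -/
theorem congrEquiv_gen (x : A) (hx : x ∈ I) :
    congrEquiv e I a (blowupAlgebra.gen I a x hx) =
      blowupAlgebra.gen (I.map e.toRingHom) (e a) (e x) (Ideal.mem_map_of_mem e.toRingHom hx) :=
  blowupAlgebraMap_gen e.toRingHom I _ a le_rfl x hx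

/-- The inverse of `congrEquiv` on the image of `A'`. [folklore] -/
@[simp]
theorem congrEquiv_symm_algebraMap (r : A') :
    (congrEquiv e I a).symm (algebraMap A' _ r) = algebraMap A (blowupAlgebra I a) (e.symm r) := by
  apply (congrEquiv e I a).injective
  rw [RingEquiv.apply_symm_apply, congrEquiv_algebraMap, RingEquiv.apply_symm_apply]

end blowupAlgebra

/-! ## The charts of the blow-up of `𝔸ⁿ⁺¹` in the origin -/

namespace PointBlowup

variable (n : ℕ) (k : Type u) [CommRing k]

/-- The coordinate ring `k[X₀, …, X_n]` of `𝔸ⁿ⁺¹_k`. [folklore] -/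
abbrev R : Type u := MvPolynomial (Fin (n + 1)) k

/-- The ideal `I = (X₀, …, X_n)` of the origin. [folklore] -/
abbrev originIdeal : Ideal (R n k) :=
  Ideal.span (Set.range (MvPolynomial.X : Fin (n + 1) → R n k))

/-- The chart ring `Cᵢ = k[X][I/Xᵢ] ⊆ k[X][1/Xᵢ]` of the blow-up of `𝔸ⁿ⁺¹` in the origin
(Stacks 0804). [cite: StacksProject, Tag 0804] -/
abbrev Chart (i : Fin (n + 1)) : Type u :=
  blowupAlgebra (originIdeal n k) (MvPolynomial.X i : R n k)

/-- The coordinate ring `k[Y_j : j ≠ i]` of the chart `D₊(yᵢ)` of `ℙⁿ_k`, the base of the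
projection on the `i`-th chart. [folklore] -/
abbrev Base (i : Fin (n + 1)) : Type u := MvPolynomial {j : Fin (n + 1) // j ≠ i} k

variable (i : Fin (n + 1))

/-- The fraction `X_j/Xᵢ ∈ Cᵢ` (`blowupAlgebra.frac` for the family of variables). [folklore] -/
abbrev frac (j : Fin (n + 1)) : Chart n k i := blowupAlgebra.frac (MvPolynomial.X : Fin (n + 1) → R n k) i j

/-- The variable `Xᵢ` as an element of `Cᵢ` (the equation of the exceptional divisor on the
chart). [folklore] -/
abbrev exc : Chart n k i := algebraMap (R n k) (Chart n k i) (MvPolynomial.X i)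

/-- `X_j = Xᵢ · (X_j/Xᵢ)` in `Cᵢ`. [folklore] -/
theorem algebraMap_X (j : Fin (n + 1)) :
    algebraMap (R n k) (Chart n k i) (MvPolynomial.X j) = exc n k i * frac n k i j :=
  (blowupAlgebra.algebraMap_mul_gen _ _ _ _).symm

/-- `Xᵢ/Xᵢ = 1`. [folklore] -/
theorem frac_self : frac n k i i = 1 :=
  blowupAlgebra.gen_self _ _ (blowupAlgebra.mem_span_range _ i)

/-- **The chart ring map of the projection**: `βᵢ : k[Y_j : j ≠ i] → Cᵢ`, `Y_j ↦ X_j/Xᵢ`.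
[cite: DeJong1996, Lemma 4.11 (proof), p. 68] -/
def baseHom : Base n k i →ₐ[k] Chart n k i :=
  MvPolynomial.aeval fun j => frac n k i j.1

/-- `βᵢ(Y_j) = X_j/Xᵢ`. [folklore] -/
@[simp]
theorem baseHom_X (j : {j : Fin (n + 1) // j ≠ i}) : baseHom n k i (MvPolynomial.X j) = frac n k i j.1 :=
  MvPolynomial.aeval_X _ j

/-- `βᵢ` on constants. [folklore] -/
@[simp]
theorem baseHom_C (c : k) : baseHom n k i (MvPolynomial.C c) = algebraMap k (Chart n k i) c :=
  MvPolynomial.algHom_C _ c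

/-- **`(k[Y_j : j ≠ i])[T] → Cᵢ`, `T ↦ Xᵢ`** (over `βᵢ`). [folklore] -/
def polyHom : MvPolynomial Unit (Base n k i) →+* Chart n k i :=
  MvPolynomial.eval₂Hom (baseHom n k i).toRingHom fun _ => exc n k i

/-- `polyHom` on `B`: it is `βᵢ`. [folklore] -/
@[simp]
theorem polyHom_C (b : Base n k i) : polyHom n k i (MvPolynomial.C b) = baseHom n k i b :=
  MvPolynomial.eval₂Hom_C _ _ b

/-- `polyHom(T) = Xᵢ`. [folklore] -/
@[simp]
theorem polyHom_X (t : Unit) : polyHom n k i (MvPolynomial.X t) = exc n k i :=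
  MvPolynomial.eval₂Hom_X' _ _ t

/-- `polyHom` restricted to `B` along `B → B[T]` is `βᵢ`. [folklore] -/
theorem polyHom_comp_algebraMap :
    (polyHom n k i).comp (algebraMap (Base n k i) (MvPolynomial Unit (Base n k i))) =
      (baseHom n k i).toRingHom := by
  ext b
  · simp
  · simp

/-! ### Surjectivity: `Cᵢ` is generated over `k` by `Xᵢ` and the `X_j/Xᵢ` -/

/-- The image of `k[X]` lies in the range of `polyHom`: `X_j = Xᵢ · (X_j/Xᵢ)`. [folklore] -/
theorem algebraMap_mem_range_polyHom (r : R n k) :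
    algebraMap (R n k) (Chart n k i) r ∈ (polyHom n k i).range := by
  induction r using MvPolynomial.induction_on with
  | C c =>
    refine ⟨MvPolynomial.C (MvPolynomial.C c), ?_⟩
    rw [polyHom_C, baseHom_C]
    exact (IsScalarTower.algebraMap_apply k (R n k) (Chart n k i) c).symm
  | add p q hp hq =>
    rw [map_add]
    exact add_mem hp hq
  | mul_X p j hp =>
    rw [map_mul, algebraMap_X]
    refine mul_mem hp (mul_mem ⟨MvPolynomial.X (), polyHom_X n k i ()⟩ ?_)
    by_cases hj : j = i
    · subst hj
      rw [frac_self]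
      exact one_mem _
    · exact ⟨MvPolynomial.C (MvPolynomial.X ⟨j, hj⟩), by rw [polyHom_C, baseHom_X]⟩

/-- **`polyHom` is surjective**: every element of `Cᵢ` is a `k[X]`-polynomial in the `X_j/Xᵢ`
(`blowupAlgebra.eval_surjective`), and `k[X]` itself lies in the range. [folklore] -/
theorem polyHom_surjective : Function.Surjective (polyHom n k i) := by
  intro c
  obtain ⟨h, rfl⟩ := blowupAlgebra.eval_surjective (MvPolynomial.X : Fin (n + 1) → R n k) i c
  change blowupAlgebra.eval MvPolynomial.X i h ∈ (polyHom n k i).range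
  induction h using MvPolynomial.induction_on with
  | C r =>
    rw [blowupAlgebra.eval_C]
    exact algebraMap_mem_range_polyHom n k i r
  | add p q hp hq =>
    rw [map_add]
    exact add_mem hp hq
  | mul_X p j hp =>
    rw [map_mul, blowupAlgebra.eval_X]
    exact mul_mem hp ⟨MvPolynomial.C (MvPolynomial.X j), by rw [polyHom_C, baseHom_X]⟩

/-! ### Injectivity: `k[X][1/Xᵢ] → k[Y][T, T⁻¹]`, `Xᵢ ↦ T`, `X_j ↦ Y_j T` -/

/-- `k[X] → k[Y][T]`, `Xᵢ ↦ T`, `X_j ↦ Y_j · T` (`j ≠ i`). [folklore] -/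
def toPoly : R n k →ₐ[k] MvPolynomial Unit (Base n k i) :=
  MvPolynomial.aeval fun j =>
    if h : j = i then MvPolynomial.X () else MvPolynomial.C (MvPolynomial.X ⟨j, h⟩) * MvPolynomial.X ()

/-- `toPoly(Xᵢ) = T`. [folklore] -/
theorem toPoly_X_self : toPoly n k i (MvPolynomial.X i) = MvPolynomial.X () := by
  simp [toPoly]

/-- `toPoly(X_j) = Y_j T` for `j ≠ i`. [folklore] -/
theorem toPoly_X_of_ne {j : Fin (n + 1)} (h : j ≠ i) :
    toPoly n k i (MvPolynomial.X j) = MvPolynomial.C (MvPolynomial.X ⟨j, h⟩) * MvPolynomial.X () := by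
  simp [toPoly, h]

/-- The variable `T` is a non-zero-divisor of `k[Y][T]`. [folklore] -/
theorem X_unit_mem_nonZeroDivisors :
    (MvPolynomial.X () : MvPolynomial Unit (Base n k i)) ∈ nonZeroDivisors _ :=
  (MvPolynomial.isRegular_X).mem_nonZeroDivisors

/-- `k[X][1/Xᵢ] → k[Y][T][1/T]` extending `toPoly` (`Xᵢ ↦ T` becomes a unit). [folklore] -/
def toLaurent : Localization.Away (MvPolynomial.X i : R n k) →+*
    Localization.Away (MvPolynomial.X () : MvPolynomial Unit (Base n k i)) :=
  IsLocalization.Away.lift (MvPolynomial.X i : R n k)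
    (g := (algebraMap (MvPolynomial Unit (Base n k i)) _).comp (toPoly n k i).toRingHom)
    (by
      rw [RingHom.comp_apply, AlgHom.toRingHom_eq_coe, RingHom.coe_coe, toPoly_X_self]
      exact IsLocalization.Away.algebraMap_isUnit _)

/-- `toLaurent` extends `toPoly`. [folklore] -/
theorem toLaurent_algebraMap (r : R n k) :
    toLaurent n k i (algebraMap (R n k) _ r) = algebraMap _ _ (toPoly n k i r) :=
  IsLocalization.Away.lift_eq _ _ r

/-- `toLaurent(Xᵢ) · toLaurent(1/Xᵢ) = 1`. [folklore] -/
theorem toLaurent_algebraMap_X_mul_invSelf :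
    toLaurent n k i (algebraMap (R n k) _ (MvPolynomial.X i)) *
        toLaurent n k i (Away.invSelf (MvPolynomial.X i : R n k)) = 1 := by
  rw [← map_mul, Away.mul_invSelf, map_one]

/-- `toLaurent` on a fraction `X_j/Xᵢ`, `j ≠ i`: it is `Y_j`. [folklore] -/
theorem toLaurent_coe_frac {j : Fin (n + 1)} (h : j ≠ i) :
    toLaurent n k i (frac n k i j : Localization.Away (MvPolynomial.X i : R n k)) =
      algebraMap (MvPolynomial Unit (Base n k i))
        (Localization.Away (MvPolynomial.X () : MvPolynomial Unit (Base n k i)))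
        (MvPolynomial.C (MvPolynomial.X (⟨j, h⟩ : {j : Fin (n + 1) // j ≠ i}))) := by
  have hT := toLaurent_algebraMap_X_mul_invSelf n k i
  rw [toLaurent_algebraMap, toPoly_X_self] at hT
  rw [blowupAlgebra.coe_frac, map_mul, toLaurent_algebraMap, toPoly_X_of_ne n k i h, map_mul,
    mul_assoc, hT, mul_one]

/-- `toLaurent` on `Xᵢ/Xᵢ`-free form: on `frac i i = 1`. [folklore] -/
theorem toLaurent_coe_frac_self :
    toLaurent n k i (frac n k i i : Localization.Away (MvPolynomial.X i : R n k)) = 1 := by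
  rw [frac_self, OneMemClass.coe_one, map_one]

/-- **`toLaurent ∘ polyHom` is the localization map `k[Y][T] → k[Y][T][1/T]`** (checked on `Y_j`,
on constants and on `T`). [folklore] -/
theorem toLaurent_comp_val_comp_polyHom :
    ((toLaurent n k i).comp (blowupAlgebra (originIdeal n k) (MvPolynomial.X i)).val.toRingHom).comp
        (polyHom n k i) =
      algebraMap (MvPolynomial Unit (Base n k i)) (Localization.Away (MvPolynomial.X ())) := by
  refine MvPolynomial.ringHom_ext (fun b => ?_) (fun t => ?_)
  · rw [RingHom.comp_apply, polyHom_C]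
    change toLaurent n k i ((baseHom n k i b : Chart n k i) : Localization.Away _) = _
    induction b using MvPolynomial.induction_on with
    | C c =>
      rw [baseHom_C]
      change toLaurent n k i (algebraMap k (Localization.Away (MvPolynomial.X i : R n k)) c) = _
      rw [IsScalarTower.algebraMap_apply k (R n k) (Localization.Away (MvPolynomial.X i : R n k)),
        toLaurent_algebraMap, AlgHom.commutes]
      rfl
    | add p q hp hq =>
      rw [map_add, Subalgebra.coe_add, map_add, hp, hq, map_add, map_add]
    | mul_X p j hp =>
      rw [map_mul, Subalgebra.coe_mul, map_mul, hp, baseHom_X, toLaurent_coe_frac n k i j.2,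
        ← map_mul, ← map_mul]
  · rw [RingHom.comp_apply, polyHom_X]
    change toLaurent n k i (algebraMap (R n k) _ (MvPolynomial.X i)) = _
    rw [toLaurent_algebraMap, toPoly_X_self]

/-- **`polyHom` is injective.** [folklore] -/
theorem polyHom_injective : Function.Injective (polyHom n k i) := by
  have hinj : Function.Injective
      (algebraMap (MvPolynomial Unit (Base n k i))
        (Localization.Away (MvPolynomial.X () : MvPolynomial Unit (Base n k i)))) :=
    IsLocalization.injective (M := Submonoid.powers (MvPolynomial.X () : MvPolynomial Unit (Base n k i)))
      (Localization.Away (MvPolynomial.X () : MvPolynomial Unit (Base n k i)))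
      (Submonoid.powers_le.mpr (X_unit_mem_nonZeroDivisors n k i))
  rw [← toLaurent_comp_val_comp_polyHom n k i, RingHom.coe_comp] at hinj
  exact hinj.of_comp

/-- **`Cᵢ = k[X][I/Xᵢ]` is the polynomial ring `k[X_j/Xᵢ : j ≠ i][Xᵢ]`**: `polyHom` is
bijective. [cite: EisenbudHarris2016, §9.3.2] -/
theorem polyHom_bijective : Function.Bijective (polyHom n k i) :=
  ⟨polyHom_injective n k i, polyHom_surjective n k i⟩

/-- The ring isomorphism `(k[Y_j : j ≠ i])[T] ≅ Cᵢ`, `T ↦ Xᵢ`, `Y_j ↦ X_j/Xᵢ`. [folklore] -/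
def polyEquiv : MvPolynomial Unit (Base n k i) ≃+* Chart n k i :=
  RingEquiv.ofBijective _ (polyHom_bijective n k i)

/-- `polyEquiv` is `polyHom` on elements. [folklore] -/
@[simp]
theorem polyEquiv_apply (p : MvPolynomial Unit (Base n k i)) : polyEquiv n k i p = polyHom n k i p :=
  rfl

/-! ### Smoothness of the projection on the chart -/

/-- `B[T]` (one variable) is a smooth `B`-algebra. [folklore] -/
instance smooth_mvPolynomial_unit (B : Type u) [CommRing B] : Algebra.Smooth B (MvPolynomial Unit B) where

/-- **The chart ring map `βᵢ : k[Y_j : j ≠ i] → Cᵢ` of the projection `q` is smooth** (it is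
`B → B[T]` followed by an isomorphism). [cite: DeJong1996, Lemma 4.11 (proof), p. 68] -/
theorem smooth_baseHom : (baseHom n k i).toRingHom.Smooth := by
  rw [← polyHom_comp_algebraMap]
  exact RingHom.Smooth.comp (RingHom.smooth_algebraMap.mpr inferInstance)
    (RingHom.Smooth.of_bijective (polyHom_bijective n k i))

/-- `βᵢ` is of finite presentation (part of smoothness; recorded for the scheme-level
`LocallyOfFinitePresentation`). [folklore] -/
theorem finitePresentation_baseHom : (baseHom n k i).toRingHom.FinitePresentation :=
  (smooth_baseHom n k i).finitePresentation

/-! ### The exceptional divisor of the chart: `Cᵢ/(Xᵢ) ≅ k[Y_j : j ≠ i]` -/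

/-- The composite `k[Y_j : j ≠ i] → Cᵢ → Cᵢ/(Xᵢ)`. [folklore] -/
def quotientBaseHom : Base n k i →+* Chart n k i ⧸ Ideal.span {exc n k i} :=
  (Ideal.Quotient.mk _).comp (baseHom n k i).toRingHom

/-- In `B[T]`: a polynomial is congruent to its constant term... precisely, every `p` is
`C(p₀) + T · p'`. [folklore] -/
theorem exists_eq_C_add_X_mul (B : Type u) [CommRing B] (p : MvPolynomial Unit B) :
    ∃ (b : B) (p' : MvPolynomial Unit B), p = MvPolynomial.C b + MvPolynomial.X () * p' := by
  induction p using MvPolynomial.induction_on with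
  | C b => exact ⟨b, 0, by simp⟩
  | add p q hp hq =>
    obtain ⟨b, p', rfl⟩ := hp
    obtain ⟨c, q', rfl⟩ := hq
    exact ⟨b + c, p' + q', by simp only [map_add]; ring⟩
  | mul_X p t hp =>
    obtain ⟨b, p', rfl⟩ := hp
    obtain rfl : t = () := rfl
    exact ⟨0, MvPolynomial.C b + MvPolynomial.X () * p', by simp only [map_zero]; ring⟩

/-- **`k[Y_j : j ≠ i] → Cᵢ/(Xᵢ)` is surjective**: modulo `Xᵢ = T` every element of
`Cᵢ = B[T]` is a constant. [folklore] -/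
theorem quotientBaseHom_surjective : Function.Surjective (quotientBaseHom n k i) := by
  intro c
  obtain ⟨c, rfl⟩ := Ideal.Quotient.mk_surjective c
  obtain ⟨p, rfl⟩ := polyHom_surjective n k i c
  obtain ⟨b, p', rfl⟩ := exists_eq_C_add_X_mul (Base n k i) p
  refine ⟨b, ?_⟩
  rw [quotientBaseHom, RingHom.comp_apply, Ideal.Quotient.eq, map_add, polyHom_C]
  have : (baseHom n k i).toRingHom b - (baseHom n k i b + polyHom n k i (MvPolynomial.X () * p')) =
      -(exc n k i * polyHom n k i p') := by
    rw [map_mul, polyHom_X, AlgHom.toRingHom_eq_coe, RingHom.coe_coe]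
    ring
  rw [this, neg_mem_iff]
  exact Ideal.mul_mem_right _ _ (Ideal.mem_span_singleton_self _)

/-- The constant term map `B[T] → B`, `T ↦ 0`. [folklore] -/
def constCoeffHom (B : Type u) [CommRing B] : MvPolynomial Unit B →+* B :=
  MvPolynomial.eval₂Hom (RingHom.id B) fun _ => 0

/-- The constant term of a constant. [folklore] -/
@[simp]
theorem constCoeffHom_C (B : Type u) [CommRing B] (b : B) : constCoeffHom B (MvPolynomial.C b) = b :=
  MvPolynomial.eval₂Hom_C _ _ b

/-- The constant term of `T` is `0`. [folklore] -/
@[simp]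
theorem constCoeffHom_X (B : Type u) [CommRing B] (t : Unit) : constCoeffHom B (MvPolynomial.X t) = 0 :=
  MvPolynomial.eval₂Hom_X' _ _ t

/-- **`k[Y_j : j ≠ i] → Cᵢ/(Xᵢ)` is injective**: if `βᵢ(b) = Xᵢ · c` then, read in `B[T]` through
`polyEquiv`, `C(b) = T · p'`, whose constant term gives `b = 0`. [folklore] -/
theorem quotientBaseHom_injective : Function.Injective (quotientBaseHom n k i) := by
  rw [injective_iff_map_eq_zero]
  intro b hb
  rw [quotientBaseHom, RingHom.comp_apply, Ideal.Quotient.eq_zero_iff_mem,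
    Ideal.mem_span_singleton'] at hb
  obtain ⟨c, hc⟩ := hb
  obtain ⟨p', rfl⟩ := polyHom_surjective n k i c
  -- `polyHom (p' * T) = polyHom (C b)`, so `p' * T = C b` in `B[T]`
  have h1 : polyHom n k i (p' * MvPolynomial.X ()) = polyHom n k i (MvPolynomial.C b) := by
    rw [map_mul, polyHom_X, polyHom_C]
    exact hc
  have h2 := polyHom_injective n k i h1
  have h3 := congrArg (constCoeffHom (Base n k i)) h2
  simpa using h3.symm

/-- **The exceptional divisor of the chart is the base: `k[Y_j : j ≠ i] ≅ Cᵢ/(Xᵢ)`.**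
[cite: EisenbudHarris2016, §9.3.2] -/
theorem quotientBaseHom_bijective : Function.Bijective (quotientBaseHom n k i) :=
  ⟨quotientBaseHom_injective n k i, quotientBaseHom_surjective n k i⟩

/-- The isomorphism `k[Y_j : j ≠ i] ≅ Cᵢ/(Xᵢ)` induced by `βᵢ`. [folklore] -/
def quotientBaseEquiv : Base n k i ≃+* Chart n k i ⧸ Ideal.span {exc n k i} :=
  RingEquiv.ofBijective _ (quotientBaseHom_bijective n k i)

/-- `quotientBaseEquiv` on elements. [folklore] -/
@[simp]
theorem quotientBaseEquiv_apply (b : Base n k i) :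
    quotientBaseEquiv n k i b = Ideal.Quotient.mk _ (baseHom n k i b) :=
  rfl

/-- `Xᵢ` is a non-zero-divisor of `Cᵢ` (it is a unit of `k[X][1/Xᵢ] ⊇ Cᵢ`): the exceptional divisor
`V(Xᵢ)` of the chart is an effective Cartier divisor. [cite: StacksProject, Tag 07Z3 (1)] -/
theorem exc_mem_nonZeroDivisors : exc n k i ∈ nonZeroDivisors (Chart n k i) :=
  algebraMap_mem_nonZeroDivisors_blowupAlgebra

/-- The ideal of the origin becomes principal on the chart: `I · Cᵢ = (Xᵢ)`.
[cite: StacksProject, Tag 07Z3 (2)] -/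
theorem map_originIdeal_eq_span :
    (originIdeal n k).map (algebraMap (R n k) (Chart n k i)) = Ideal.span {exc n k i} :=
  map_blowupAlgebra_eq_span (blowupAlgebra.mem_span_range _ i)

end PointBlowup

end Literature.AlgebraicGeometry.Resolution

end
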